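import Mathlib.GroupTheory.Commutator.Basic
import Literature.AnabelianGeometry.AbsoluteAnabelian.FreeProfiniteCommutatorCusp
import Literature.GroupTheory.CocycleCentralExtension
import HarnessLib

/-!
# The cusp of a once-punctured closed surface, profinitely: `⟨∏[a_i, b_i]⟩⁻` in a free profinite group is free procyclic and injects into the cuspidally central quotient

Group theory behind the `(g, r) = (g, 1)` instance (`g ≥ 1`) of [AbsTopIII] Prop. 1.4 / Thm. 1.9 (b)
(Mochizuki, *Topics in Absolute Anabelian Geometry III*, §1, Prop. 1.4 (i)/(ii) p. 31, Thm. 1.9 (b)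
p. 37, manuscript, lit key `paper:url-5493eb38cbb7`): for the closed orientable surface `Z_g` punctured
once, `U = Z_g ∖ {z}`, one has `Δ_U = F̂_{2g} = ⟨a_i, b_i⟩^` free profinite ([AbsTopI] Lem. 4.5 (i)),
the inertia group of the cusp is `I_z = ⟨c_g⟩⁻`, `c_g = ∏_{i<g} [a_i, b_i]` the surface relator,
`Δ_{Z_g} = F̂_{2g} / ⟨⟨c_g⟩⟩⁻` (the profinite completion of the surface group), and Prop. 1.4 (ii)
says `1 → I_z → Δ^{c-cn}_U → Δ_{Z_g} → 1` is exact.  This PROOF-ONLY file (no definitions, no named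
facts) generalises abc-iut's `FreeProfiniteCommutatorCusp.lean` (the case `g = 1`, `c = [a, b]`) in
two steps:

* §1 — for ANY element `c` of a profinite group `P` with **central images of every order** (for
  each `m ≥ 1` a continuous homomorphism to a finite group carrying `c` to a central element of order
  exactly `m`): `⟨c⟩⁻` is free procyclic (`isFreeProcyclic_topologicalClosure_zpowers_of_centralImages`;
  centrality not needed here) and **`⟨c⟩⁻ ∩ [⟨⟨c⟩⟩⁻, P]⁻ = 1`**
  (`topologicalClosure_zpowers_inf_eq_bot_of_centralImages`; the joint maps `P → P/U × K_m`);
* §2 — in a free pro-`Σ` group on generators `a_i := gens (castAdd g i)`, `b_i := gens (natAdd g i)`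
  (`Σ ⊇ {primes}`, `g ≥ 1`; abc-iut-L4-t4's `IsFreeProOn`) the surface relator `c_g` HAS central
  images of every order (`IsFreeProOn.centralImages_surfaceRelator`: into the Heisenberg group
  `H(ℤ/m)`, `a_0 ↦ x`, `b_0 ↦ y`, every other generator `↦ 1`, so `c_g ↦ [x, y]`), whence
  `IsFreeProOn.isFreeProcyclic_topologicalClosure_zpowers_surfaceRelator`,
  `topologicalClosure_zpowers_surfaceRelator_le` (`⟨c_g⟩⁻ ≤ [P, P]⁻`) and
  `IsFreeProOn.topologicalClosure_zpowers_surfaceRelator_inf_eq_bot`.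

Consumer: the closed-surface MODEL of the `CurveModel` interface (`AbsTopIII/CurveModelClosedSurface.lean`),
a genuine hyperbolic cyclotome presentation at which F-0338 / F-0365 / F-0346 fire non-vacuously.
HONEST FRAMING: classical (pro)finite group theory; nothing here bears on [IUTchIII] Cor. 3.12.
-/

noncomputable section

open Topology

namespace Literature.AnabelianGeometry.AbsoluteAnabelian

open Literature.GroupTheory

universe u

/-! ### §1 Central images of every order -/

/-- For every `m ≥ 1` there is a finite group with two elements whose commutator is CENTRAL of order
exactly `m` — the Heisenberg group `H(ℤ/m) = (ℤ/m)² ×_c ℤ/m` for the bilinear cocycle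
`c((x,y),(x',y')) = x y'` (the tree's `TwistedProduct`; same construction as the private lemma of
`FreeProfiniteCommutatorCusp.lean`, restated here because that one is private). [folklore] -/
private theorem exists_finite_group_commutator_central (m : ℕ) (hm : 0 < m) :
    ∃ (K : Type) (_ : Group K) (_ : Finite K) (x y : K),
      x * y * x⁻¹ * y⁻¹ ∈ Subgroup.center K ∧ orderOf (x * y * x⁻¹ * y⁻¹) = m := by
  haveI : NeZero m := ⟨hm.ne'⟩
  let c : CentralCocycle (Multiplicative (ZMod m × ZMod m)) (Multiplicative (ZMod m)) :=
    { toFun := fun g h =>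
        Multiplicative.ofAdd ((Multiplicative.toAdd g).1 * (Multiplicative.toAdd h).2)
      cocycle' := fun g h l => by
        rw [← ofAdd_add, ← ofAdd_add, toAdd_mul, toAdd_mul, Prod.fst_add, Prod.snd_add]
        congr 1
        ring
      map_one_one' := by
        rw [toAdd_one, Prod.fst_zero, zero_mul, ofAdd_zero] }
  let x : TwistedProduct c := ⟨Multiplicative.ofAdd (1, 0), 1⟩
  let y : TwistedProduct c := ⟨Multiplicative.ofAdd (0, 1), 1⟩
  have hxy' : x * y = TwistedProduct.inl c (Multiplicative.ofAdd 1) * (y * x) := by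
    refine TwistedProduct.ext ?_ ?_
    · change Multiplicative.ofAdd ((1 : ZMod m), (0 : ZMod m)) * Multiplicative.ofAdd (0, 1) =
        1 * (Multiplicative.ofAdd (0, 1) * Multiplicative.ofAdd (1, 0))
      rw [one_mul, mul_comm]
    · change (1 : Multiplicative (ZMod m)) * 1 * Multiplicative.ofAdd ((1 : ZMod m) * 1) =
        Multiplicative.ofAdd (1 : ZMod m) * (1 * 1 * Multiplicative.ofAdd ((0 : ZMod m) * 0)) *
          c 1 (Multiplicative.ofAdd (0, 1) * Multiplicative.ofAdd (1, 0))
      rw [CentralCocycle.map_one_left, mul_one, mul_zero, ofAdd_zero, mul_one, one_mul, one_mul,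
        mul_one, mul_one]
  have hxy : x * y * x⁻¹ * y⁻¹ = TwistedProduct.inl c (Multiplicative.ofAdd 1) := by
    simp only [hxy', mul_assoc, mul_inv_cancel, mul_one]
  refine ⟨TwistedProduct c, inferInstance, ?_, x, y, ?_, ?_⟩
  · exact Finite.of_equiv (Multiplicative (ZMod m × ZMod m) × Multiplicative (ZMod m))
      ⟨fun p => ⟨p.1, p.2⟩, fun z => (z.g, z.a), fun _ => rfl, fun _ => rfl⟩
  · rw [hxy]
    exact TwistedProduct.inl_mem_center _
  · rw [hxy, orderOf_injective (TwistedProduct.inl c) TwistedProduct.inl_injective,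
      orderOf_ofAdd_eq_addOrderOf, ZMod.addOrderOf_one]

section CentralImages

variable {P : Type u} [Group P] [TopologicalSpace P] [IsTopologicalGroup P]

/-- Under a continuous homomorphism to a DISCRETE group the closure `⟨c⟩⁻` maps into `⟨ψ c⟩`
(`ψ(⟨c⟩⁻) ⊆ (ψ⟨c⟩)⁻ = ⟨ψ c⟩`). [folklore] -/
private theorem map_mem_zpowers_of_mem_closure_zpowers {K : Type*} [Group K] [TopologicalSpace K]
    [DiscreteTopology K] (ψ : P →* K) (hψ : Continuous ψ) (c : P) {x : P}
    (hx : x ∈ (Subgroup.zpowers c).topologicalClosure) : ψ x ∈ Subgroup.zpowers (ψ c) := by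
  have h1 : ψ x ∈ closure (ψ '' (Subgroup.zpowers c : Set P)) :=
    image_closure_subset_closure_image hψ ⟨x, hx, rfl⟩
  rw [(isClosed_discrete _).closure_eq] at h1
  obtain ⟨p, hp, hpx⟩ := h1
  obtain ⟨k, rfl⟩ := Subgroup.mem_zpowers_iff.mp hp
  rw [← hpx, map_zpow]
  exact ⟨k, rfl⟩

/-- The image of a topological closure under a continuous homomorphism to a discrete group is the image
of the subgroup itself. [folklore] -/
private theorem map_topologicalClosure_eq_of_discrete {K : Type*} [Group K] [TopologicalSpace K]
    [DiscreteTopology K] (ψ : P →* K) (hψ : Continuous ψ) (H : Subgroup P) :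
    H.topologicalClosure.map ψ = H.map ψ := by
  refine le_antisymm ?_ (Subgroup.map_mono (Subgroup.le_topologicalClosure H))
  rintro _ ⟨x, hx, rfl⟩
  have h1 : ψ x ∈ closure (ψ '' (H : Set P)) := image_closure_subset_closure_image hψ ⟨x, hx, rfl⟩
  rw [(isClosed_discrete _).closure_eq] at h1
  obtain ⟨p, hp, hpx⟩ := h1
  exact ⟨p, hp, hpx⟩

/-- **`⟨c⟩⁻` is free procyclic** as soon as `c` has images of EVERY order under continuous
homomorphisms to finite groups: `⟨c⟩` is dense in `⟨c⟩⁻`, and the kernel of `⟨c⟩⁻ → K_m` is an open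
subgroup of index `m` (its image is `⟨ψ c⟩`, of order `m`) — the group-theoretic content of "the
inertia group `I_x` [...] is naturally isomorphic to `Ẑ(1)`" for such cusps.
[cite: MochizukiAbsTopIII2015, Prop 1.4 (i) p.31] -/
theorem isFreeProcyclic_topologicalClosure_zpowers_of_centralImages (c : P)
    (hc : ∀ m : ℕ, 0 < m → ∃ (K : Type) (_ : Group K) (_ : Finite K) (_ : TopologicalSpace K)
      (_ : DiscreteTopology K) (ψ : P →* K), Continuous ψ ∧ orderOf (ψ c) = m) :
    FundamentalExtension.IsFreeProcyclic (Subgroup.zpowers c).topologicalClosure := by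
  classical
  have hcI : c ∈ (Subgroup.zpowers c).topologicalClosure :=
    Subgroup.le_topologicalClosure _ (Subgroup.mem_zpowers c)
  refine ⟨⟨⟨c, hcI⟩, ?_⟩, fun m hm => ?_⟩
  · rw [Topology.IsInducing.subtypeVal.dense_iff]
    rintro ⟨x, hx⟩
    refine closure_mono ?_ hx
    rintro p hp
    obtain ⟨k, rfl⟩ := Subgroup.mem_zpowers_iff.mp hp
    exact ⟨⟨c, hcI⟩ ^ k, ⟨k, rfl⟩, Subgroup.coe_zpow _ _ _⟩
  · obtain ⟨K, _, _, _, _, ψ, hψc, hord⟩ := hc m hm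
    let φ : (Subgroup.zpowers c).topologicalClosure →* K :=
      ψ.comp (Subgroup.zpowers c).topologicalClosure.subtype
    have hφc : Continuous φ := hψc.comp continuous_subtype_val
    have hrange : φ.range = Subgroup.zpowers (ψ c) := by
      apply le_antisymm
      · rintro _ ⟨x, rfl⟩
        exact map_mem_zpowers_of_mem_closure_zpowers ψ hψc c x.2
      · rw [Subgroup.zpowers_le]
        exact ⟨⟨c, hcI⟩, rfl⟩
    refine ⟨φ.ker, ?_, ?_⟩
    · rw [MonoidHom.coe_ker]
      exact (isOpen_discrete _).preimage hφc
    · rw [Subgroup.index_ker, hrange, Nat.card_zpowers, hord]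

variable [CompactSpace P] [TotallyDisconnectedSpace P]

/-- **`⟨c⟩⁻ ∩ [N, P]⁻ = 1`** for `N := ⟨⟨c⟩⟩⁻` the closed normal subgroup generated by `⟨c⟩⁻`, as soon
as `c` has CENTRAL images of every order: an element `x` of the intersection lies in every open normal
`U` — with `m` the order of `c` mod `U` and `ψ : P → K_m` carrying `c` to a central `z` of order `m`,
the joint continuous map `P → P/U × K_m` sends `⟨c⟩⁻` into `⟨(c mod U, z)⟩`, so
`(x mod U, ψ x) = (c^k mod U, z^k)`; `ψ` kills `[N, P]⁻` (`ψ(N)` is central), so `z^k = 1`, `m ∣ k`,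
`x ≡ c^k ≡ 1 mod U`.  (The injectivity of `I_z → Δ^{c-cn}` in [AbsTopIII] Prop. 1.4 (ii) for the cusp
of a once-punctured closed surface.) [cite: MochizukiAbsTopIII2015, Prop 1.4 (ii) p.31] -/
theorem topologicalClosure_zpowers_inf_eq_bot_of_centralImages (c : P)
    (hc : ∀ m : ℕ, 0 < m → ∃ (K : Type) (_ : Group K) (_ : Finite K) (_ : TopologicalSpace K)
      (_ : DiscreteTopology K) (ψ : P →* K),
        Continuous ψ ∧ ψ c ∈ Subgroup.center K ∧ orderOf (ψ c) = m) :
    (Subgroup.zpowers c).topologicalClosure ⊓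
      (⁅(Subgroup.normalClosure ((Subgroup.zpowers c).topologicalClosure : Set P)).topologicalClosure,
        (⊤ : Subgroup P)⁆).topologicalClosure = ⊥ := by
  classical
  set I := (Subgroup.zpowers c).topologicalClosure with hI
  set N := (Subgroup.normalClosure (I : Set P)).topologicalClosure with hN
  rw [eq_bot_iff]
  rintro x ⟨hxI, hxJ⟩
  rw [Subgroup.mem_bot]
  by_contra hx1
  obtain ⟨U, hU⟩ := ProfiniteGrp.exist_openNormalSubgroup_sub_open_nhds_of_one
    (isOpen_compl_singleton (x := x)) (show (1 : P) ∈ ({x}ᶜ : Set P) from fun h => hx1 h.symm)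
  apply hU _ rfl
  show x ∈ (U : Subgroup P)
  haveI : Finite (P ⧸ (U : Subgroup P)) := Subgroup.quotient_finite_of_isOpen _ U.isOpen'
  haveI : DiscreteTopology (P ⧸ (U : Subgroup P)) := QuotientGroup.discreteTopology U.isOpen'
  obtain ⟨K, _, _, _, _, ψ, hψc, hz, hord⟩ :=
    hc (orderOf (QuotientGroup.mk c : P ⧸ (U : Subgroup P))) (orderOf_pos _)
  let Ψ : P →* (P ⧸ (U : Subgroup P)) × K := (QuotientGroup.mk' (U : Subgroup P)).prod ψ
  have hΨc : Continuous Ψ := QuotientGroup.continuous_mk.prodMk hψc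
  obtain ⟨k, hk⟩ := Subgroup.mem_zpowers_iff.mp (map_mem_zpowers_of_mem_closure_zpowers Ψ hΨc c hxI)
  have hk1 : (QuotientGroup.mk c : P ⧸ (U : Subgroup P)) ^ k = QuotientGroup.mk x :=
    congrArg Prod.fst hk
  have hk2 : (ψ c) ^ k = ψ x := congrArg Prod.snd hk
  have hψI : I.map ψ ≤ Subgroup.center K := by
    rw [hI, map_topologicalClosure_eq_of_discrete ψ hψc, MonoidHom.map_zpowers, Subgroup.zpowers_le]
    exact hz
  have hψN : N.map ψ ≤ Subgroup.center K := by
    rw [hN, map_topologicalClosure_eq_of_discrete ψ hψc, Subgroup.map_le_iff_le_comap]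
    exact Subgroup.normalClosure_le_normal (Subgroup.map_le_iff_le_comap.mp hψI)
  have hψJ : (⁅N, (⊤ : Subgroup P)⁆).topologicalClosure.map ψ = ⊥ := by
    rw [map_topologicalClosure_eq_of_discrete ψ hψc, Subgroup.map_commutator, eq_bot_iff]
    have h0 : ⁅Subgroup.center K, (⊤ : Subgroup K)⁆ = ⊥ := by
      rw [Subgroup.commutator_eq_bot_iff_le_centralizer]
      intro k hk
      rw [Subgroup.mem_centralizer_iff]
      intro l _
      exact Subgroup.mem_center_iff.mp hk l
    rw [← h0]
    exact Subgroup.commutator_mono hψN le_top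
  have hψx : ψ x = 1 := by
    rw [← Subgroup.mem_bot, ← hψJ]
    exact Subgroup.mem_map_of_mem ψ hxJ
  rw [hψx, ← orderOf_dvd_iff_zpow_eq_one, hord, orderOf_dvd_iff_zpow_eq_one, hk1] at hk2
  exact (QuotientGroup.eq_one_iff x).mp hk2

end CentralImages

/-! ### §2 The surface relator `∏_{i<g} [a_i, b_i]` in a free profinite group -/

section SurfaceRelator

variable {P : Type u} [Group P] [TopologicalSpace P]
  {S : Set ℕ} {g : ℕ} {gens : Fin (g + g) → P}

omit [TopologicalSpace P] in
/-- A product of commutators lies in the commutator subgroup: `∏_{i<g} [a_i, b_i] ∈ [P, P]`. [folklore] -/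
private theorem surfaceRelator_mem_commutator (a b : Fin g → P) :
    ((List.finRange g).map fun i => a i * b i * (a i)⁻¹ * (b i)⁻¹).prod ∈
      ⁅(⊤ : Subgroup P), (⊤ : Subgroup P)⁆ := by
  refine Subgroup.list_prod_mem _ fun x hx => ?_
  obtain ⟨i, -, rfl⟩ := List.mem_map.mp hx
  have h := Subgroup.commutator_mem_commutator (Subgroup.mem_top (a i)) (Subgroup.mem_top (b i))
    (H₁ := (⊤ : Subgroup P)) (H₂ := (⊤ : Subgroup P))
  rwa [commutatorElement_def] at h

/-- `⟨∏[a_i, b_i]⟩⁻ ≤ [P, P]⁻` (one puncture on a closed surface: the cusp's inertia dies in the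
abelianisation). [cite: MochizukiAbsTopIII2015, Prop 1.4 (ii) p.31] -/
theorem topologicalClosure_zpowers_surfaceRelator_le [IsTopologicalGroup P] (a b : Fin g → P) :
    (Subgroup.zpowers ((List.finRange g).map fun i => a i * b i * (a i)⁻¹ * (b i)⁻¹).prod).topologicalClosure
      ≤ (⁅(⊤ : Subgroup P), (⊤ : Subgroup P)⁆).topologicalClosure := by
  apply Subgroup.topologicalClosure_mono
  rw [Subgroup.zpowers_le]
  exact surfaceRelator_mem_commutator a b

/-- **The surface relator has central images of every order.**  For a free pro-`Σ` group `P` on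
generators `a_i := gens (castAdd g i)`, `b_i := gens (natAdd g i)` (`Σ ⊇ {primes}`, `g ≥ 1`) and every
`m ≥ 1`, the continuous homomorphism to the Heisenberg group `H(ℤ/m)` with `a_0 ↦ x`, `b_0 ↦ y` and
every other generator `↦ 1` carries `∏_{i<g} [a_i, b_i]` to `[x, y]`, central of order `m`.
[cite: MochizukiAbsTopI2012, Lemma 4.5 (i) p.54] -/
theorem IsFreeProOn.centralImages_surfaceRelator (hS : ∀ p : ℕ, p.Prime → p ∈ S)
    (hP : IsFreeProOn P S gens) (hg : 0 < g) (m : ℕ) (hm : 0 < m) :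
    ∃ (K : Type) (_ : Group K) (_ : Finite K) (_ : TopologicalSpace K) (_ : DiscreteTopology K)
      (ψ : P →* K), Continuous ψ ∧
        ψ ((List.finRange g).map fun i => gens (Fin.castAdd g i) * gens (Fin.natAdd g i) *
            (gens (Fin.castAdd g i))⁻¹ * (gens (Fin.natAdd g i))⁻¹).prod ∈ Subgroup.center K ∧
        orderOf (ψ ((List.finRange g).map fun i => gens (Fin.castAdd g i) * gens (Fin.natAdd g i) *
            (gens (Fin.castAdd g i))⁻¹ * (gens (Fin.natAdd g i))⁻¹).prod) = m := by
  classical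
  obtain ⟨K, _, _, x, y, hz, hord⟩ := exists_finite_group_commutator_central m hm
  letI : TopologicalSpace K := ⊥
  haveI : DiscreteTopology K := ⟨rfl⟩
  obtain ⟨g', rfl⟩ : ∃ g', g = g' + 1 := ⟨g - 1, (Nat.sub_add_cancel hg).symm⟩
  -- the generator values: `a_0 ↦ x`, `b_0 ↦ y`, all others `↦ 1`
  let i₀ : Fin (g' + 1 + (g' + 1)) := Fin.castAdd (g' + 1) 0
  let j₀ : Fin (g' + 1 + (g' + 1)) := Fin.natAdd (g' + 1) 0
  obtain ⟨ψ, ⟨hψc, hψ⟩, -⟩ := hP.2 K (fun q hq _ => hS q hq)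
    (fun k => if k = i₀ then x else if k = j₀ then y else 1)
  have hi₀ : ψ (gens i₀) = x := by rw [hψ, if_pos rfl]
  have hj₀ : ψ (gens j₀) = y := by
    have hne : j₀ ≠ i₀ := by
      intro h
      have := congrArg Fin.val h
      simp [i₀, j₀] at this
    rw [hψ, if_neg hne, if_pos rfl]
  have hother : ∀ i : Fin g', ψ (gens (Fin.castAdd (g' + 1) i.succ)) = 1 := by
    intro i
    have h1 : Fin.castAdd (g' + 1) i.succ ≠ i₀ := by
      intro h
      exact Fin.succ_ne_zero i (Fin.castAdd_injective _ _ h)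
    have h2 : Fin.castAdd (g' + 1) i.succ ≠ j₀ := by
      intro h
      have := congrArg Fin.val h
      simp [j₀] at this
      omega
    rw [hψ, if_neg h1, if_neg h2]
  -- the image of the surface relator is `[x, y]`
  have himg : ψ ((List.finRange (g' + 1)).map fun i => gens (Fin.castAdd (g' + 1) i) *
      gens (Fin.natAdd (g' + 1) i) * (gens (Fin.castAdd (g' + 1) i))⁻¹ *
        (gens (Fin.natAdd (g' + 1) i))⁻¹).prod = x * y * x⁻¹ * y⁻¹ := by
    rw [map_list_prod, List.map_map, List.finRange_succ, List.map_cons, List.prod_cons, List.map_map]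
    have htail : ((List.finRange g').map ((⇑ψ ∘ fun i => gens (Fin.castAdd (g' + 1) i) *
        gens (Fin.natAdd (g' + 1) i) * (gens (Fin.castAdd (g' + 1) i))⁻¹ *
          (gens (Fin.natAdd (g' + 1) i))⁻¹) ∘ Fin.succ)).prod = 1 := by
      refine List.prod_eq_one fun w hw => ?_
      obtain ⟨i, -, rfl⟩ := List.mem_map.mp hw
      simp only [Function.comp_apply, map_mul, map_inv, hother i, one_mul, inv_one, mul_one, mul_inv_cancel]
    rw [htail, mul_one]
    simp only [Function.comp_apply, map_mul, map_inv]
    rw [show Fin.castAdd (g' + 1) (0 : Fin (g' + 1)) = i₀ from rfl,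
      show Fin.natAdd (g' + 1) (0 : Fin (g' + 1)) = j₀ from rfl, hi₀, hj₀]
  exact ⟨K, inferInstance, inferInstance, inferInstance, inferInstance, ψ, hψc,
    himg ▸ hz, himg ▸ hord⟩

variable [IsTopologicalGroup P]

/-- **`⟨∏[a_i, b_i]⟩⁻` is free procyclic** in a free pro-`Σ` group on the `a_i, b_i` (`Σ ⊇ {primes}`,
`g ≥ 1`): the inertia group of the cusp of a once-punctured closed surface of genus `g`, profinitely.
[cite: MochizukiAbsTopI2012, Lemma 4.5 (i) p.54] -/
theorem IsFreeProOn.isFreeProcyclic_topologicalClosure_zpowers_surfaceRelator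
    (hS : ∀ p : ℕ, p.Prime → p ∈ S) (hP : IsFreeProOn P S gens) (hg : 0 < g) :
    FundamentalExtension.IsFreeProcyclic
      (Subgroup.zpowers ((List.finRange g).map fun i => gens (Fin.castAdd g i) * gens (Fin.natAdd g i) *
        (gens (Fin.castAdd g i))⁻¹ * (gens (Fin.natAdd g i))⁻¹).prod).topologicalClosure :=
  isFreeProcyclic_topologicalClosure_zpowers_of_centralImages _ fun m hm => by
    obtain ⟨K, _, _, _, _, ψ, hψc, -, hord⟩ := hP.centralImages_surfaceRelator hS hg m hm
    exact ⟨K, inferInstance, inferInstance, inferInstance, inferInstance, ψ, hψc, hord⟩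

variable [CompactSpace P] [TotallyDisconnectedSpace P]

/-- **`⟨c_g⟩⁻ ∩ [⟨⟨c_g⟩⟩⁻, P]⁻ = 1`** for the surface relator `c_g = ∏[a_i, b_i]` in a free pro-`Σ`
group on the `a_i, b_i` (`Σ ⊇ {primes}`, `g ≥ 1`): the cusp's inertia INJECTS into the maximal
cuspidally central quotient `Π_U / [N, Π_U]⁻` ([AbsTopIII] Prop. 1.4 (ii) for `U = Z_g ∖ {z}`).
[cite: MochizukiAbsTopIII2015, Prop 1.4 (ii) p.31] -/
theorem IsFreeProOn.topologicalClosure_zpowers_surfaceRelator_inf_eq_bot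
    (hS : ∀ p : ℕ, p.Prime → p ∈ S) (hP : IsFreeProOn P S gens) (hg : 0 < g) :
    (Subgroup.zpowers ((List.finRange g).map fun i => gens (Fin.castAdd g i) * gens (Fin.natAdd g i) *
        (gens (Fin.castAdd g i))⁻¹ * (gens (Fin.natAdd g i))⁻¹).prod).topologicalClosure ⊓
      (⁅(Subgroup.normalClosure ((Subgroup.zpowers ((List.finRange g).map fun i =>
          gens (Fin.castAdd g i) * gens (Fin.natAdd g i) * (gens (Fin.castAdd g i))⁻¹ *
            (gens (Fin.natAdd g i))⁻¹).prod).topologicalClosure : Set P)).topologicalClosure,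
        (⊤ : Subgroup P)⁆).topologicalClosure = ⊥ :=
  topologicalClosure_zpowers_inf_eq_bot_of_centralImages _ (hP.centralImages_surfaceRelator hS hg)

end SurfaceRelator

end Literature.AnabelianGeometry.AbsoluteAnabelian
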